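import Summits.QuantumFields.YangMills.Theorems.UnitScaleTiltProp8HalvingAssemblyInterior
import Summits.QuantumFields.YangMills.Theorems.UnitScaleTiltProp8HalvingChartP1Display
import Summits.QuantumFields.YangMills.Theorems.UnitScaleTiltProp8ChartDoubleBarDefs
import HarnessLib

/-!
# Route `UnitScaleTilt`, crux K1 child «MinimiserStabilityRegPr» (stmt-QuantumFields-19200), registered stub V2′ `stub_halvingStep` (v8∕v10 `BirthV10`) —
# **PILLAR P1♭ AS ONE `Prop` (THE P1♭ TEXT OF RECORD, ★★OWNER RULINGS g26-№14 (H ROWS) ∕ №16 (5) ∕ №17 (B)) AND ITS KNIT INTO M3's DISPLAYED `hP1`** — the symmetrised flat twin of [Balaban1985RegularSpaces] Thm 2 ∕ [Balaban1985Variational] Prop. 2 (18)–(21) and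
# Sect. F (152)–(156), (160), over the cell's letters (`emlAvgU`-fibre `regFibrePr`, block frames `vframeU` ∕ double-bar tower `dbarIterU`, chart
# `chartLogFlat`), at the aligned cube sequence `cubeSeqMT3 F n K x ρ S M` of a site `x`; plus the DESIGN CONSTRAINT D-P1 (RULING g26-№13 (i)) as a
# separate `def`.

Cell `ym3-torus` (HUMAN RULING D-0037, YM ladder rung R3 — continuum SU(2) YM₃ on the torus is a RUNG, not the Clay problem), width seat `ym-ust-19200-w3` gen 4.
`--supports stmt-QuantumFields-19200 --as helper`; DEFINITIONS LANE (three `def … : Prop` with parameters = predicates, one knit theorem); 0 sorry, standard axioms.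
The pillar itself (an inhabitant of `P1FlatPillar`) is programme row WANTED №g26-5 «Thm 2♭ on T³» and is NOT proved here; nothing here claims the stub, the crux or the gap.

PROVENANCE OF THE CONJUNCTS (print = [Balaban1985Variational] unless marked [B8] = [Balaban1985RegularSpaces]):
* `DP1Clause` — DESIGNED (RULINGS №13 (i)∕№16 (5)∕№17 (B2), the clause of record, GROUP form): the double-bar top average of the gauge copy `u⁻¹Uu` on
  the interior top bonds of the member IS the axial copy (`holT`∕`contourT` at the top block of `x`) of the ℰp top average — print (154) first case with (147),
  SYMMETRISED (double-bar tower, torus tree gauge); serves the fibre half of S12 (Φ-1); print's gauge mechanism ([B8] (1.29), (144)) is not displayed.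
* `P1FlatPillarAt` (i) `A` Hermitian, traceless — print (19)∕(152) «U₁ = e^{iηA}», 𝔰𝔲(2) reading (VERBATIM); (ii) chart identity «U^{u} = e^{iηA} on Ω′_j,
  j ≥ 1» in the algebraic letters of M3's `hP1` (✓p607414) on the member's own tower `SideTouches (pullDom {InOm j} j)`, `1 ≤ j ≤ k` — the letter region of
  ✓p607904 `HalvingSize152Dictionary`; SYMMETRISED BY ANALOGY (print's Ω′₀ = Π has no twin: `Domains.Om 0 = univ`; M3's one-point layer at `x` is the case
  `j = k` by monotonicity of `SideTouches` in the set); (iii) (152)∕[B8] (1.36) sup and gradient sizes in the `IsLevWeight` rows of M3's `hP1` conjuncts 4–5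
  BY SHAPE (✓p607904 dictionary), right-hand side `B₁ε₀` as print's `9dL²B₁Mε₀` under the regime `Cr·ε₁ ≤ ε₀` (VERBATIM shape); (iv) (153)∕[B8] (1.38)
  Landau slice in the SITE-average multiplier form of M3's `hP1` conjunct 6 (✓p607449 dictionary ⟸ `IsLandau138 … 1 (pull A 0)`) (VERBATIM modulo the
  dictionary); (v) [the LOG-form data identity `chartLogFlat … A c = B27T …` — DROPPED from the displayed text by RULING g26-№18 (D): no consumer;
  the pillar's future prover derives (vi) from it + ✓p592665 internally]; (vi) (160) «|B(c)| <
  (8d²L² + 4L²|c₋ − y|)ε₁» in the `hnear` currency of `HalvingAssemblyInterior.H_of_packageInt` with the BARE `chartLogFlat` (at `j = k`, `Lᵏη = 1`: census §4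
  `bondAvgIter_top_chartPreimage`; ★w7-19200 g0 08:10:43Z) — VERBATIM shape, constant `C₁` (today's supplier ✓`HalvingDatum160.norm_datum160_le` gives `6` from (v));
  (vii) (155)∕[B8] (1.37) «|B| < 18d²L³Mε₀» — every chart datum is `O(ε₀)` (VERBATIM analogue; ⟹ `pkg`'s `hfar` after the unit normalisation
  `(Lʲη)⁻¹ = L^{k−j}`).
* `P1FlatPillar` — the INPUT side of `H_of_packageInt`'s `pkg` VERBATIM (`PlaqSmall ε₁ V`, `U ∈ regFibrePr F n K _ ε₀ V`, every site `x`), the regime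
  `0 < ε₁`, `0 < ε₀ ≤ a`, `Cr·ε₁ ≤ ε₀` (print: `ε₀ = O(1)B₃ε₁`, (158) ff.), constants `(a, Cr, B₁, C₁, C₂)` and the cube-sequence geometry `(ρ, S, M)` as
  parameters (fixed outside `pkg` exactly as in `H_of_packageInt`).
NOT INCLUDED (by design, say so if wanted): uniqueness of `u` and print's averaged gauge conditions [B8] (1.29)∕(144) (Prop. 2's bijection; no H-side socket
consumes them); the third∕fourth members of (152) (`(Lʲη)³|∂*∂A|, |ΔA|` — [B8] (1.39)); the regularity half S12b of (Φ-1) (★w7-19200 g0 08:10:43Z); print's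
level-0 collar `Ω′₀ = Π`.
LOCATED HAZARD (Λ₀-cut; for the P1♭ prover and the (iv)-consumers, not a defect of any landed file): `Domains.Om 0 = univ`, so `Λ₀ = T ∖ blocks(Ω₁)` is the
whole far torus, where no gauge copy of a general `U ∈ 𝔅_k(V) ∩ RegPr` is `O(ε₀)`-close to `1` (the holonomies of `V` are free) — hence (ii) is asked on the
levels `≥ 1` only, and (iii)∕(vii) force `A` to be `O(ε₀Lᵏ)`∕`O(ε₀)`-small on Λ₀ (e.g. `A = 0` there); the multiplier form (iv) is then VACUOUS at the Λ₀ index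
sites (`siteAvgIter 0 = id`, free multipliers) but a genuine condition at the Ω₁-sites within distance 2 of Λ₀, which print's `R` for `{Ω″_j}`, `Ω″₀ = Π`
(Neumann-type on ∂Π) does not state — whoever proves P1♭ must either realise (iv) across that cut or have (iv) weakened there by its consumer (the (165)-row).
-/

set_option autoImplicit false

noncomputable section

open scoped BigOperators Matrix.Norms.L2Operator

namespace Summit.QuantumFields.YangMills.Theorems.HalvingP1FlatPillar

open Literature.MathematicalPhysics.QuantumFieldTheory.Balaban1983to89
open Literature.MathematicalPhysics.QuantumFieldTheory.Balaban1983to89.T3ContinuumYM3Torus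
open Literature.MathematicalPhysics.QuantumFieldTheory.Balaban1983to89.T3PrintedRegularMinimiser
open Literature.MathematicalPhysics.QuantumFieldTheory.Balaban1983to89.T3Thm1Carrier
open Literature.MathematicalPhysics.QuantumFieldTheory.Balaban1983to89.T3UnitLawDensityEML (ℰp)
open Complex (I)
open B5Eq117TorusCarriers (Mk)
open B5Eq118OneStroke (iterBlockOf)
open B5Prop12FieldsLattice (distSite distSite_self)
open B6SectADomainsV1 (Domains)
open B6SectAOperatorsV1 (BondIdx SiteIdx)
open B7Prop1Explicit (expUnit)
open B8Eq140Level (SideTouches sideTouches_mono)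
open B8Thm2SetupTorus (pullDom)
open B10Eq27TorusAxialLog (transl unitsField toUField gaugeActT holT contourT)
open LatticeFieldCalculus (laplace diverg siteAvgIter)
open FlatCubeOpsText (IsLevWeight)
open FlatCubeSequenceAligned (cubeSeqMT3)
open HalvingQuarterCubeSeq (inOm_top_of_dist)
open Summit.QuantumFields.YangMills.Theorems.Prop8ChartDoubleBar (dbarIterU chartLogFlat)

variable (F : T3Family) (n K : ℕ)

/-- **DESIGN CONSTRAINT D-P1 — THE CLAUSE OF RECORD** (RULINGS g26-№13 (i), №16 (5), №17 (B2)): on every TOP-level bond of the member with both ends in the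
top cube of the nested family `D`, the double-bar top average of the gauge copy `u⁻¹·U·u` IS the axial copy — read from the top block of the site `x` along lit-balaban's
contour (27) — of the ℰp top average `Ū^{(K−n)}` of `U` (= the (7)-datum `V` read on the tower for `U ∈ 𝔅_k(V)`, `T3DescentFibreTower.mem_fibre_iff`).  GROUP form (no
logarithm): it pins the effective top gauge `(u∘emb^k)⁻¹·w^{(k)}` of the double-bar tower (accumulated frames included) to the datum gauge of `HalvingDatum160`, and serves
the FIBRE half of S12 (Φ-1) (every chart configuration with this top datum single-bar-averages to a gauge copy of `V`).  Print's mechanism ([B8] (1.29) «ū_j = 1» +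
(144)∕(147) block-axial gauge at `y` + (154) first case «Ū₁ᵏ = V″ on the interior of Λ′_k») is deliberately not displayed (designed, not print verbatim).
[cite: Balaban1985Variational, (154) p.302, (147) p.301; Balaban1985UV3, (27) p.263; Balaban1985RegularSpaces, (1.29) p.81, (1.31) p.82; Balaban1985Averaging, (89) p.31] -/
def DP1Clause (D : Domains (F.P K)) (x : Site (F.P K) 0) (U : GaugeField (F.P K) 0 (Matrix.specialUnitaryGroup (Fin 2) ℂ))
    (u : GaugeTransf (F.P K) 0 (Matrix.unitaryGroup (Fin 2) ℂ)) : Prop :=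
  ∀ c : PBond (F.P K) (K - n), c.src ∈ D.Om (K - n) → c.tgt ∈ D.Om (K - n) →
    ((dbarIterU (K - n) (gaugeActT (fun s => (Unitary.toUnits (u s))⁻¹) (unitsField (toUField U))) c : (Matrix (Fin 2) (Fin 2) ℂ)ˣ) :
        Matrix (Fin 2) (Fin 2) ℂ) =
      ((holT (unitsField (toUField (Averaging.iter (fun i => BlockAveraging.blockAvg (P := F.P K) (j := i) ℰp) (K - n) U)))
          (iterBlockOf (K - n) x) (contourT (iterBlockOf (K - n) x) c) : (Matrix (Fin 2) (Fin 2) ℂ)ˣ) : Matrix (Fin 2) (Fin 2) ℂ)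

/-- **PILLAR P1♭ AT ONE SITE** (the member `F.P K`, levels `n, K`, a nested family `D` — the aligned cube sequence of `x` — the site `x`, the two regularity
parameters and the three output constants): there are a gauge map `u` and a one-form `A` with (o) the D-P1 clause of record (group form); (i) `A` bondwise Hermitian
and traceless; (ii) the chart identity
`u(z)⁻¹·U⟨z,μ⟩·u(z+e_μ) = exp(iηA⟨z,μ⟩)` on every bond side-touching a positive-level domain of the member (M3's `hP1` letters; its one-point layer at `x` is the case
`j = K − n`); (iii) the (152)∕(1.36) sup and gradient sizes `B₁ε₀` at the level weights (M3's `hP1` conjuncts 4–5 by shape); (iv) the Landau slice (153)∕(1.38) in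
site-average multiplier form (M3's `hP1` conjunct 6 verbatim); (vi) the (160) near size of the top chart datum in the `hnear` currency of
`HalvingAssemblyInterior.H_of_packageInt` (bare `chartLogFlat` at the top level, where `Lᵏη = 1` — ★w7-19200 g0's seventh conjunct); (vii) the (155)∕(1.37) global
datum size `C₂ε₀`.
[cite: Balaban1985RegularSpaces, Thm 2 p.83, (1.36)-(1.38) p.82; Balaban1985Variational, Prop 2 (18)-(21) pp.280-281, (152)-(156) pp.301-302, (160) p.303] -/
def P1FlatPillarAt (D : Domains (F.P K)) (x : Site (F.P K) 0) (ε₀ ε₁ B₁ C₁ C₂ : ℝ)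
    (U : GaugeField (F.P K) 0 (Matrix.specialUnitaryGroup (Fin 2) ℂ)) : Prop :=
  ∃ (u : GaugeTransf (F.P K) 0 (Matrix.unitaryGroup (Fin 2) ℂ)) (A : PBond (F.P K) 0 → Matrix (Fin 2) (Fin 2) ℂ),
    DP1Clause F n K D x U u ∧
    (∀ b : PBond (F.P K) 0, IsSelfAdjoint (A b)) ∧ (∀ b : PBond (F.P K) 0, Matrix.trace (A b) = 0) ∧
    (∀ j, 1 ≤ j → j ≤ K - n → ∀ (z : B7Prop1Explicit.Site (F.P K).d) (μ : Fin (F.P K).d),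
      SideTouches (pullDom (fun i => {y : Site (F.P K) 0 | D.InOm i y}) j) z μ →
      (Unitary.toUnits (u (transl 0 z)))⁻¹ * unitsField (toUField U) ⟨transl 0 z, μ⟩ * Unitary.toUnits (u ((transl 0 z).shift μ)) =
        expUnit (I • ((((F.L : ℝ)⁻¹) ^ (K - n)) • A ⟨transl 0 z, μ⟩))) ∧
    (∀ w : ℕ → PBond (F.P K) 0 → ℝ, IsLevWeight F n K D w →
      (∀ b : PBond (F.P K) 0, w 1 b * ‖A b‖ ≤ B₁ * ε₀) ∧
      (∀ (b : PBond (F.P K) 0) (ν : Fin (F.P K).d), w 2 b * (F.L : ℝ) ^ (K - n) * ‖A ⟨b.src.shift ν, b.dir⟩ - A b‖ ≤ B₁ * ε₀)) ∧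
    (∃ μ : SiteIdx D → Matrix (Fin 2) (Fin 2) ℂ, ∀ s : Site (F.P K) 0,
      laplace ((F.L : ℝ) ^ (K - n)) (diverg ((F.L : ℝ) ^ (K - n)) A) s =
        ∑ i : SiteIdx D, siteAvgIter (i.1.1 : ℕ) (Pi.single s (1 : ℝ)) i.1.2 • μ i) ∧
    (∀ c : BondIdx D, (c.1.1 : ℕ) = K - n → c.1.2.src ∈ D.Om (c.1.1 : ℕ) → c.1.2.tgt ∈ D.Om (c.1.1 : ℕ) →
      ‖chartLogFlat (((F.L : ℝ)⁻¹) ^ (K - n)) D A c‖ ≤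
        C₁ * ε₁ * (distSite (Mk (F.P K) (c.1.1 : ℕ)) c.1.2.src (iterBlockOf (c.1.1 : ℕ) x) + 1)) ∧
    (∀ c : BondIdx D, ‖chartLogFlat (((F.L : ℝ)⁻¹) ^ (K - n)) D A c‖ ≤ C₂ * ε₀)

/-- **PILLAR P1♭** (the symmetrised flat twin of [B8] Thm 2 ∕ Prop. 2 ∕ Sect. F (152)–(156), (160)) for the family with `F.L = L`, the aligned cube
sequence of inner radius `ρ`, separation `S`, big blocks `M`, the regime `0 < ε₁`, `0 < ε₀ ≤ a`, `Cr·ε₁ ≤ ε₀`, and the output constants `B₁, C₁, C₂`: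
for every (7)-datum `V` with `PlaqSmall ε₁ V`, every `U` of print's regular fibre (6) `regFibrePr F n K _ ε₀ V` and every site `x`, `P1FlatPillarAt` holds
at the cube sequence `cubeSeqMT3 F n K x ρ S M` — the input side of `HalvingAssemblyInterior.H_of_packageInt`'s `pkg` verbatim.
[cite: Balaban1985RegularSpaces, Thm 2 p.83; Balaban1985Variational, Prop 2 p.281, (144) p.300, (152)-(156) pp.301-302, (160) p.303] -/
def P1FlatPillar (L ρ S M : ℕ) (hM : 1 ≤ M) (a Cr B₁ C₁ C₂ : ℝ) : Prop :=
  ∀ F : T3Family, F.L = L → ∀ (n K : ℕ) (hnK : n < K) (ε₀ ε₁ : ℝ), 0 < ε₁ → 0 < ε₀ → ε₀ ≤ a → Cr * ε₁ ≤ ε₀ →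
    ∀ V : GaugeField (F.P n) 0 (Matrix.specialUnitaryGroup (Fin 2) ℂ), PlaqSmall ε₁ V →
      ∀ U ∈ regFibrePr F n K hnK.le ε₀ V, ∀ x : Site (F.P K) 0,
        P1FlatPillarAt F n K (cubeSeqMT3 F n K x ρ S M hM) x ε₀ ε₁ B₁ C₁ C₂ U

/-- **THE KNIT TO M3** (`HalvingChartP1Display.package_rows_of_P1disp_su2`'s displayed `hP1`, six conjuncts in its order with `δ = δ′ := B₁ε₀`) **PLUS THE SEVENTH
CONJUNCT** (★w7-19200 g0's `package_rows_of_P1disp_flat`: the (160) near row over the bare `chartLogFlat` at the top) **PLUS THE D-P1 CLAUSE** (for S12 (Φ-1)), from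
`P1FlatPillarAt` at the cube sequence of `x`: the one-point layer of `x` lies in the member's top layer (`x` is the centre of its top cube, `sideTouches_mono`), nothing else.
[cite: Balaban1985Variational, (152)-(156) pp.301-302, (160) p.303; Balaban1985RegularSpaces, Thm 2 p.83] -/
theorem hP1_of_P1FlatPillarAt (hnK : n < K) (x : Site (F.P K) 0) (ρ S M : ℕ) (hM : 1 ≤ M) {ε₀ ε₁ B₁ C₁ C₂ : ℝ}
    {U : GaugeField (F.P K) 0 (Matrix.specialUnitaryGroup (Fin 2) ℂ)}
    (h : P1FlatPillarAt F n K (cubeSeqMT3 F n K x ρ S M hM) x ε₀ ε₁ B₁ C₁ C₂ U)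
    {w : ℕ → PBond (F.P K) 0 → ℝ} (hw : IsLevWeight F n K (cubeSeqMT3 F n K x ρ S M hM) w) :
    ∃ (u : GaugeTransf (F.P K) 0 (Matrix.unitaryGroup (Fin 2) ℂ)) (A : PBond (F.P K) 0 → Matrix (Fin 2) (Fin 2) ℂ),
      ((∀ b : PBond (F.P K) 0, IsSelfAdjoint (A b)) ∧ (∀ b : PBond (F.P K) 0, Matrix.trace (A b) = 0) ∧
        (∀ (z : B7Prop1Explicit.Site (F.P K).d) (μ : Fin (F.P K).d),
          SideTouches (pullDom (fun j => if K - n ≤ j then ({x} : Set (Site (F.P K) 0)) else (∅ : Set (Site (F.P K) 0))) (K - n)) z μ →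
          (Unitary.toUnits (u (transl 0 z)))⁻¹ * unitsField (toUField U) ⟨transl 0 z, μ⟩ * Unitary.toUnits (u ((transl 0 z).shift μ)) =
            expUnit (I • ((((F.L : ℝ)⁻¹) ^ (K - n)) • A ⟨transl 0 z, μ⟩))) ∧
        (∀ b : PBond (F.P K) 0, w 1 b * ‖A b‖ ≤ B₁ * ε₀) ∧
        (∀ (b : PBond (F.P K) 0) (ν : Fin (F.P K).d), w 2 b * (F.L : ℝ) ^ (K - n) * ‖A ⟨b.src.shift ν, b.dir⟩ - A b‖ ≤ B₁ * ε₀) ∧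
        (∃ μ : SiteIdx (cubeSeqMT3 F n K x ρ S M hM) → Matrix (Fin 2) (Fin 2) ℂ, ∀ s : Site (F.P K) 0,
          laplace ((F.L : ℝ) ^ (K - n)) (diverg ((F.L : ℝ) ^ (K - n)) A) s =
            ∑ i : SiteIdx (cubeSeqMT3 F n K x ρ S M hM), siteAvgIter (i.1.1 : ℕ) (Pi.single s (1 : ℝ)) i.1.2 • μ i)) ∧
      (∀ c : BondIdx (cubeSeqMT3 F n K x ρ S M hM), (c.1.1 : ℕ) = K - n →
        c.1.2.src ∈ (cubeSeqMT3 F n K x ρ S M hM).Om (c.1.1 : ℕ) → c.1.2.tgt ∈ (cubeSeqMT3 F n K x ρ S M hM).Om (c.1.1 : ℕ) →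
        ‖chartLogFlat (((F.L : ℝ)⁻¹) ^ (K - n)) (cubeSeqMT3 F n K x ρ S M hM) A c‖ ≤
          C₁ * ε₁ * (distSite (Mk (F.P K) (c.1.1 : ℕ)) c.1.2.src (iterBlockOf (c.1.1 : ℕ) x) + 1)) ∧
      DP1Clause F n K (cubeSeqMT3 F n K x ρ S M hM) x U u := by
  obtain ⟨u, A, hdp1, hsa, htr, hchart, hsize, hslice, hnear, -⟩ := h
  have hx : (cubeSeqMT3 F n K x ρ S M hM).InOm (K - n) x := by
    have hd : 0 < (F.P K).d := by rw [T3Family.P_d]; norm_num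
    let μ : Fin (F.P K).d := ⟨0, hd⟩
    exact inOm_top_of_dist hnK x ρ S M hM (b := ⟨x, μ⟩) (r₀ := 0) (le_of_eq (distSite_self _)) (Nat.cast_nonneg ρ)
  have hsub : pullDom (fun j => if K - n ≤ j then ({x} : Set (Site (F.P K) 0)) else (∅ : Set (Site (F.P K) 0))) (K - n) ⊆
      pullDom (fun i => {y : Site (F.P K) 0 | (cubeSeqMT3 F n K x ρ S M hM).InOm i y}) (K - n) := by
    intro z hz
    have hz' : transl (0 : Site (F.P K) 0) z ∈ (if K - n ≤ K - n then ({x} : Set (Site (F.P K) 0)) else (∅ : Set (Site (F.P K) 0))) := hz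
    rw [if_pos le_rfl, Set.mem_singleton_iff] at hz'
    show (cubeSeqMT3 F n K x ρ S M hM).InOm (K - n) (transl (0 : Site (F.P K) 0) z)
    rw [hz']
    exact hx
  refine ⟨u, A, ⟨hsa, htr, fun z μ hz => hchart (K - n) (by omega) le_rfl z μ (sideTouches_mono hsub hz), (hsize w hw).1, (hsize w hw).2,
    hslice⟩, hnear, hdp1⟩

end Summit.QuantumFields.YangMills.Theorems.HalvingP1FlatPillar

end
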